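import Literature.AlgebraicTopology.KTheory.BottGL
import Literature.AlgebraicTopology.KTheory.BottLaurent
import Literature.AlgebraicTopology.KTheory.BottLinearAlg
import HarnessLib

/-!
# Linearisation in `K⁰(X × S²)`: `[θ, Lᵐ(p)] = [θ, p] + m |ι|` (Husemöller, *Fibre Bundles*, Ch. 11 Prop. 3.2)

The K-theoretic form of the linearisation step, for invertible *polynomial clutching matrices*
`p(x, z) = ∑_{k ≤ m} zᵏ aₖ(x)` of the trivial bundle (`polyClutch a`, coefficients
`aₖ ∈ M_ι(C(X, ℂ))`): with the block matrices of `BottLinearAlg.lean` over `S = C(X × S¹, ℂ)`,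

* `bottClassGL_comp_diagonal` — additivity of `[θ, ·]` over block-diagonal matrices
  (`Matrix.comp` of a diagonal of blocks), `bottClassGL_one : [θ, 1] = |ι|`;
* `LtFamily` — the homotopy `L_t = (1 + tN₁)(p ⊕ 1)(1 + tN₂)` as one invertible matrix over
  `(X × [0,1]) × S¹` with slices `L_0 = p ⊕ 1_m` and `L_1 = Lᵐ(p)`;
* **`bottClassGL_comp_Lmat`**: `[θ, Lᵐ(p)] = [θ, p] + m |ι|` in `K⁰(X × S²)`.

Everything is proved; no named facts.

## References

* D. Husemöller, *Fibre Bundles*, 3rd ed. (1994) [HusemollerFibreBundles1994]: Ch. 11 §3,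
  Notation 3.1, Prop. 3.2; Ch. 10 Prop. 1.5.
-/

noncomputable section

open Set Metric unitInterval

namespace Literature.AlgebraicTopology.KTheory

open Literature.RingTheory.KTheory Matrix Linearization

universe u

variable {X : Type u} [TopologicalSpace X] [CompactSpace X] [T2Space X]
variable {ι : Type} [Fintype ι] [DecidableEq ι]

/-! ### Block-diagonal clutching matrices -/

/-- Splitting off the first block: `Fin (m+2) × ι ≃ ι ⊕ (Fin (m+1) × ι)`. [folklore] -/
def finSuccProdEquiv (m : ℕ) (ι : Type*) : Fin (m + 2) × ι ≃ ι ⊕ (Fin (m + 1) × ι) where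
  toFun p := Fin.cases (Sum.inl p.2) (fun r ↦ Sum.inr (r, p.2)) p.1
  invFun s := Sum.elim (fun i ↦ ((0 : Fin (m + 2)), i)) (fun q ↦ (q.1.succ, q.2)) s
  left_inv p := by
    obtain ⟨r, i⟩ := p
    induction r using Fin.cases <;> simp
  right_inv s := by
    rcases s with i | ⟨r, i⟩ <;> simp

omit [TopologicalSpace X] [CompactSpace X] [T2Space X] [Fintype ι] [DecidableEq ι] in
/-- A block-diagonal matrix splits off its first block. [folklore] -/
theorem reindex_comp_diagonal {R : Type*} [Zero R] {m : ℕ} (d : Fin (m + 2) → Matrix ι ι R) [DecidableEq ι] :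
    Matrix.reindex (finSuccProdEquiv m ι) (finSuccProdEquiv m ι) (Matrix.comp _ _ _ _ _ (Matrix.diagonal d)) =
      Matrix.fromBlocks (d 0) 0 0 (Matrix.comp _ _ _ _ _ (Matrix.diagonal (d ∘ Fin.succ))) := by
  ext s s' : 1
  rcases s with i | ⟨r, i⟩ <;> rcases s' with j | ⟨r', j⟩
  · simp [finSuccProdEquiv, Matrix.comp, Matrix.diagonal]
  · simp [finSuccProdEquiv, Matrix.comp, Matrix.diagonal, (Fin.succ_ne_zero r').symm]
  · simp [finSuccProdEquiv, Matrix.comp, Matrix.diagonal, Fin.succ_ne_zero]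
  · by_cases h : r = r'
    · subst h; simp [finSuccProdEquiv, Matrix.comp, Matrix.diagonal]
    · simp [finSuccProdEquiv, Matrix.comp, Matrix.diagonal, h, Fin.succ_injective _ |>.ne h]

omit [TopologicalSpace X] [CompactSpace X] [T2Space X] in
/-- A block diagonal of units is a unit (entry level). [folklore] -/
theorem isUnit_comp_diagonal {R : Type*} [CommRing R] {m : ℕ} (d : Fin (m + 1) → Matrix ι ι R) (hd : ∀ r, IsUnit (d r)) :
    IsUnit (Matrix.comp _ _ _ _ _ (Matrix.diagonal d)) := by
  have h : IsUnit (Matrix.diagonal d : Matrix (Fin (m + 1)) (Fin (m + 1)) (Matrix ι ι R)) := by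
    refine ⟨⟨Matrix.diagonal d, Matrix.diagonal fun r ↦ ((hd r).unit⁻¹ : (Matrix ι ι R)ˣ), ?_, ?_⟩, rfl⟩
    · rw [Matrix.diagonal_mul_diagonal, ← Matrix.diagonal_one]; congr 1; ext r : 1; exact (hd r).mul_val_inv
    · rw [Matrix.diagonal_mul_diagonal, ← Matrix.diagonal_one]; congr 1; ext r : 1; exact (hd r).val_inv_mul
  exact h.map (Matrix.compRingEquiv (Fin (m + 1)) ι R)

/-- **Additivity over block diagonals**: `[θ, diag(d₀, …, d_m)] = ∑ᵣ [θ, dᵣ]`.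
[cite: HusemollerFibreBundles1994, Ch. 10 Prop. 1.5] -/
theorem bottClassGL_comp_diagonal {m : ℕ} (d : Fin (m + 1) → Matrix ι ι C(↥(pieceUp X ∩ pieceDn X), ℂ))
    (hd : ∀ r, IsUnit (d r)) :
    bottClassGL (Matrix.comp _ _ _ _ _ (Matrix.diagonal d)) = ∑ r, bottClassGL (d r) := by
  induction m with
  | zero =>
    rw [Fin.sum_univ_one, ← bottClassGL_reindex _ (Equiv.uniqueProd ι (Fin 1))]
    congr 1
  | succ m ih =>
    rw [Fin.sum_univ_succ, ← bottClassGL_reindex _ (finSuccProdEquiv m ι), reindex_comp_diagonal,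
      bottClassGL_fromBlocks _ _ (hd 0) (isUnit_comp_diagonal (d ∘ Fin.succ) fun r ↦ hd r.succ), ih (d ∘ Fin.succ) (fun r ↦ hd r.succ)]
    rfl

/-! ### The trivial clutching matrix -/

omit [CompactSpace X] [T2Space X] in
/-- The trivial bundle `θ_ι` over `X × S²` is clutched from the identity matrix. [folklore] -/
theorem isClutchedGL_one : IsClutchedGL ((1 : Matrix ι ι C(X, ℂ)).map (comapRingHom (prX X))) (1 : Matrix ι ι C(↥(pieceUp X ∩ pieceDn X), ℂ)) := by
  have hQ : ((1 : Matrix ι ι C(X, ℂ)).map (comapRingHom (prX X))) = 1 := Matrix.map_one _ (map_zero _) (map_one _)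
  rw [hQ]
  refine ⟨{ x₁ := 1, y₁ := 1, x₂ := 1, y₂ := 1,
            hxy₁ := by rw [Matrix.map_one _ (map_zero _) (map_one _), Matrix.mul_one],
            hyx₁ := Matrix.mul_one _, hx₁ := by rw [Matrix.mul_one, Matrix.mul_one], hy₁ := by rw [Matrix.mul_one, Matrix.mul_one],
            hxy₂ := by rw [Matrix.map_one _ (map_zero _) (map_one _), Matrix.mul_one],
            hyx₂ := Matrix.mul_one _, hx₂ := by rw [Matrix.mul_one, Matrix.mul_one], hy₂ := by rw [Matrix.mul_one, Matrix.mul_one] }, ?_⟩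
  change (1 : Matrix ι ι _).map (ovl₂ (pieceUp X) (pieceDn X)) * (1 : Matrix ι ι _).map (ovl₁ (pieceUp X) (pieceDn X)) = 1
  rw [Matrix.map_one _ (map_zero _) (map_one _), Matrix.map_one _ (map_zero _) (map_one _), Matrix.mul_one]

/-- **`[θ, 1] = rank`**: the identity clutching matrix gives the trivial bundle of rank `|ι|`.
[cite: HusemollerFibreBundles1994, Ch. 11 Notation 2.7] -/
theorem bottClassGL_one : bottClassGL (1 : Matrix ι ι C(↥(pieceUp X ∩ pieceDn X), ℂ)) = (Fintype.card ι : K0 (X × S2r)) := by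
  rw [← (isClutchedGL_one (X := X) (ι := ι)).of_ofMatrix_eq, ← KZero.of_unit_eq_natCast]
  apply KZero.of_eq_of
  refine (Idem.algEquivalent_ofMatrix _ _).trans ?_
  rw [Matrix.map_one _ (map_zero _) (map_one _)]
  change AlgEquivalent (1 : Matrix ι ι C(X × S2r, ℂ)) (1 : Matrix (Fin (Fintype.card ι)) (Fin (Fintype.card ι)) C(X × S2r, ℂ))
  have h := AlgEquivalent.reindex (IsIdempotentElem.one (M := Matrix ι ι C(X × S2r, ℂ))) (Fintype.equivFin ι)
  rwa [Matrix.reindex_apply, Matrix.submatrix_one_equiv] at h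

/-! ### Polynomial clutching matrices and the linearisation theorem -/

variable {m : ℕ}

/-- The coefficients `aₖ(x)` pulled back to `X × S¹`. [cite: HusemollerFibreBundles1994, Ch. 11 Def. 2.4] -/
abbrev coeffA (a : Fin (m + 1) → Matrix ι ι C(X, ℂ)) : Fin (m + 1) → Matrix ι ι C(↥(pieceUp X ∩ pieceDn X), ℂ) :=
  fun k ↦ (a k).map (comapRingHom πA)

/-- **The polynomial clutching matrix `p(x, z) = ∑ₖ zᵏ aₖ(x)`.** [cite: HusemollerFibreBundles1994, Ch. 11 Def. 2.4] -/
abbrev polyClutch (a : Fin (m + 1) → Matrix ι ι C(X, ℂ)) : Matrix ι ι C(↥(pieceUp X ∩ pieceDn X), ℂ) :=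
  polyEval (coeffA a) zA

omit [CompactSpace X] [T2Space X] in
/-- Auxiliary statement for the linearisation theorem. [folklore] -/
theorem comapRingHom_fstOverlap_zA : comapRingHom (fstOverlap (X := X)) zA = zA := rfl

omit [CompactSpace X] [T2Space X] in
/-- Auxiliary statement for the linearisation theorem. [folklore] -/
theorem comapRingHom_sliceOverlap_zA (t : I) : comapRingHom (sliceOverlap (X := X) t) zA = zA := rfl

omit [CompactSpace X] [T2Space X] in
/-- Auxiliary statement for the linearisation theorem. [folklore] -/
theorem comapRingHom_sliceOverlap_sCoord (t : I) :
    comapRingHom (sliceOverlap (X := X) t) sCoord = algebraMap ℂ _ ((t : ℝ) : ℂ) := by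
  ext z; rfl

/-- The homotopy `L_t`, `t ∈ [0,1]`, as an invertible matrix over `(X × [0,1]) × S¹`. [cite: HusemollerFibreBundles1994, Ch. 11 Prop. 3.2] -/
def LtFamily (a : Fin (m + 1) → Matrix ι ι C(X, ℂ)) : Matrix (Fin (m + 1) × ι) (Fin (m + 1) × ι) C(↥(pieceUp (X × I) ∩ pieceDn (X × I)), ℂ) :=
  Matrix.comp _ _ _ _ _ (Lt (fun k ↦ (coeffA a k).map (comapRingHom fstOverlap)) zA sCoord)

omit [CompactSpace X] [T2Space X] in
/-- Auxiliary statement for the linearisation theorem. [folklore] -/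
theorem isUnit_LtFamily (a : Fin (m + 1) → Matrix ι ι C(X, ℂ)) (hp : IsUnit (polyClutch a)) : IsUnit (LtFamily a) := by
  obtain ⟨pu, hpu⟩ := hp
  set a' : Fin (m + 1) → Matrix ι ι C(↥(pieceUp (X × I) ∩ pieceDn (X × I)), ℂ) := fun k ↦ (coeffA a k).map (comapRingHom fstOverlap)
  have hp' : polyEval a' zA = (polyClutch a).map (comapRingHom fstOverlap) := by
    rw [polyEval_map]; rfl
  set pinv := (↑pu⁻¹ : Matrix ι ι _).map (comapRingHom (fstOverlap (X := X)))
  have h1 : polyEval a' zA * pinv = 1 := by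
    rw [hp', ← Matrix.map_mul, ← hpu, pu.mul_inv, Matrix.map_one _ (map_zero _) (map_one _)]
  have h2 : pinv * polyEval a' zA = 1 := by
    rw [hp', ← Matrix.map_mul, ← hpu, pu.inv_mul, Matrix.map_one _ (map_zero _) (map_one _)]
  have hL : IsUnit (Lt a' zA sCoord) := ⟨⟨_, _, Lt_mul_LtInv a' zA sCoord h1, LtInv_mul_Lt a' zA sCoord h2⟩, rfl⟩
  exact hL.map (Matrix.compRingEquiv (Fin (m + 1)) ι _)

omit [CompactSpace X] [T2Space X] in
/-- Auxiliary statement for the linearisation theorem. [folklore] -/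
theorem LtFamily_slice (a : Fin (m + 1) → Matrix ι ι C(X, ℂ)) (t : I) :
    (LtFamily a).map (comapRingHom (restrictMap (baseMap (sliceIncl t))
        (mapsTo_inter (mapsTo_baseMap_pieceUp _) (mapsTo_baseMap_pieceDn _)))) =
      Matrix.comp _ _ _ _ _ (Lt (coeffA a) zA (algebraMap ℂ _ ((t : ℝ) : ℂ))) := by
  rw [LtFamily, comp_Lt_map]
  congr 2

/-- **Linearisation (Husemöller Ch. 11 Prop. 3.2)**: for a polynomial clutching matrix `p` of degree
`≤ m` of the trivial bundle `θ_ι`, `[θ, Lᵐ(p)] = [θ, p] + m |ι|` in `K⁰(X × S²)` — via the homotopy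
`L_t = (1 + tN₁)(p ⊕ 1)(1 + tN₂)` from `p ⊕ 1_m` to `Lᵐ(p)`. [cite: HusemollerFibreBundles1994, Ch. 11 Prop. 3.2] -/
theorem bottClassGL_comp_Lmat (a : Fin (m + 1) → Matrix ι ι C(X, ℂ)) (hp : IsUnit (polyClutch a)) :
    bottClassGL (Matrix.comp _ _ _ _ _ (Lmat (coeffA a) zA)) = bottClassGL (polyClutch a) + (m * Fintype.card ι : ℕ) := by
  -- homotopy from `D = p ⊕ 1` to `Lᵐ(p)`
  have hhom := bottClassGL_eq_of_homotopy (Matrix.comp _ _ _ _ _ (Dmat (coeffA a) zA)) (Matrix.comp _ _ _ _ _ (Lmat (coeffA a) zA))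
    (LtFamily a) (isUnit_LtFamily a hp) (by rw [LtFamily_slice]; simp [Lt_zero]) (by rw [LtFamily_slice]; simp [Lt_one])
  rw [← hhom, Dmat, bottClassGL_comp_diagonal]
  · rw [Fin.sum_univ_succ]
    simp only [Fin.succ_ne_zero, if_false, if_true, bottClassGL_one, Finset.sum_const, Finset.card_univ, Fintype.card_fin,
      nsmul_eq_mul, Nat.cast_mul]
  · intro r
    by_cases hr : r = 0
    · simp only [hr, if_true]; exact hp
    · simp only [hr, if_false]; exact isUnit_one

end Literature.AlgebraicTopology.KTheory

end
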